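import Summits.QuantumFields.BalabanUV.Beta.EriceFlowEnclosureB12AsPrintedHistoryUnique

/-!
# Beta / EriceFlowEnclosureB12AsPrintedHistoryNonunique — TWO DISTINCT BARE COUPLINGS, ONE RENORMALIZED COUPLING: under a UNIFORM
# (non-fading) history modulus «g₀ = g₀(ε, g)» is NOT a function at large depth — the explicit two-run witness (β-flow team, prover 1 =
# recursion ∕ upper ∕ bare-coupling ∕ UNIQUENESS side, unit `b2b-balaban-beta-bflow-p1`, gen 34; ROW AP-I·C × ROW U; PART 1 = #61e
# `…B12AsPrintedHistoryUnique` (uniqueness under FADING memory, θ < 1), PART 2 = `…B12AsPrintedHistoryUniformDepth` (gen 34: uniqueness under a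
# uniform modulus UP TO depth ≍ b³∕C²); this file = the β-level core of the NECESSITY WITNESS; `…HistoryNonuniqueEnd` chooses the parameters)

HONEST FRAMING (page 1 of everything the β sub-cell writes): discharging `BetaPertH` makes Bałaban's UV stability UNCONDITIONAL — a
real constructive-QFT result; it is NOT the continuum limit and NOT the Clay problem.  HONEST DEPENDENCY (cell reorg 2026-08-19,
verbatim): «continuum YM on T⁴ ⇐ BetaPertH ∧ nine spine estimates (0/9 proved); BetaPertH ⇐ (D1) ∧ (D4) ∧ CAP+tail; G-an2-4 gates
asym, D1 and NE2/3/4.»  THIS MODULE DISCHARGES NOTHING: it studies ONE TOY FAMILY OF OURS ([folklore] objects), stated through DEFINING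
HYPOTHESES (no `def`), against the letters the cell's uniqueness theorems consume — node U2's `T4CouplingMatching.HistLipschitz Λ γ β` with
`FadingMemory C θ Λ` READ AT θ = 1 (a UNIFORM modulus 0 ≤ Λ k i ≤ C: the tree's coordinatewise clause `BetaDerivClause.CoordLipschitzAt`,
`histLipschitz_of_coordLipschitz`), `FlowStep.BetaLowerH ∕ BetaUpperH ∕ BetaContH ∕ BetaPertH` —, none of which is printed in [I] =
T. Bałaban, Commun. Math. Phys. **109** (1987) [Balaban1987RG1] (p. 298 says only that β_j *"depends also on all preceding coupling constants"*;
Theorem 2, *"there exists a bare coupling constant g₀ = g₀(ε, g)"*, p. 259, is STATED WITHOUT PROOF).  Nothing of Bałaban's β is asserted; no toy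
is claimed to resemble the construction.

THE FAMILY (depth K = 2n, band [n, 2n), amplitude ε, reference run gᴮ, normalisation M, last-variable factor χ):
  β_{j+1}(p₀, …, p_j) := b + 𝟙[n ≤ j < 2n]·ε·max(1 − |Σ_{i<n} (p_i − gᴮ_i)|∕M, 0)·χ(p_j).
THE TWO RUNS: run A is FREE, 1∕(gᴬ_i)² = x₀ − b·i; run B starts Δ = n·ε HIGHER in 1∕g², 1∕(gᴮ_i)² = x₀ − b·i + ε·(n − (i − n)₊)₊ (= Δ for
i ≤ n, decreasing by ε per step across the band, 0 from i = 2n on), and M := Σ_{i<n} (gᴬ_i − gᴮ_i).  Along A the bump reads max(1 − M∕M, 0) = 0, so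
β ≡ b and A solves (0.20); along B it reads max(1 − 0, 0)·χ(gᴮ_j) = 1 (χ = 1 on run B's band couplings), so β = b + ε on the band — exactly B's
extra decrement: B solves (0.20) too.  gᴬ_0 ≠ gᴮ_0, gᴬ_{2n} = gᴮ_{2n}: **two bare couplings, one renormalized coupling, same depth** (§19, in
the sequel `…HistoryNonuniqueRuns`; this file: the LETTERS).
THE LETTERS (§18): b ≤ β ≤ b + ε on every box; `HistLipschitz Λ` with Λ j i = 𝟙[band]·(ε∕M·𝟙[i < n] + ε·L_χ·𝟙[i = j]) — a UNIFORM modulus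
`FadingMemory C 1 Λ` as soon as ε∕M ≤ C and ε·L_χ ≤ C; (C) `BetaContH`; and even the wall letter `BetaPertH β b` with ANY constant C_p once
the bump vanishes on small boxes (n·γ′ ≤ Σ_{i<n}(2gᴮ_i − gᴬ_i) for small γ′, §17 `inv_sqrt_ge_two_thirds`) and ε ≤ C_p·τ².  The size of M
(§17 `inv_sqrt_sub_ge`: gᴬ_i − gᴮ_i ≥ Δ∕(2(x₀ + Δ)^{3∕2}), so ε∕M ≤ 2(x₀ + Δ)^{3∕2}∕n², `M_ge`) is what `…HistoryNonuniqueEnd` turns into «any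
C > 0 at depth K ≳ b³∕C²».  χ is a parameter: χ ≡ 1 (β constant in the last variable) for the β-level headline; χ = a smooth step vanishing
at 0 for the toy `Setting` of `…HistoryNonuniqueSetting` (the printed (2.13) face condition `d213`).

WHAT THIS FILE PROVES (0 sorry, 0 def):
§17 `truncSum_eq` (the Fin-sum with cut-off i < n is Σ_{i<n}), `lastSum_eq`, `inv_sqrt_sub_ge`, `inv_sqrt_ge_two_thirds`, `bump_mem_Icc`,
    `bump_sub_le`.
§18 LETTERS of the family: `betaLowerH_of_bumpFamily`, `betaUpperH_of_bumpFamily`, **`histLipschitz_of_bumpFamily`**, **`uniformModulus_of_bumpFamily`**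
    (`FadingMemory C 1 Λ`), `betaContH_of_bumpFamily`, `bump_zero_of_smallBox`, **`betaPertH_of_bumpFamily`**.
(§19 THE TWO RUNS — `rgEqH_runA ∕ rgEqH_runB ∕ runs_end_eq ∕ runs_start_lt ∕ M_ge` — is the sequel `…HistoryNonuniqueRuns`.)
NOT CLAIMED: any modulus, sign or bound for Bałaban's β; Theorem 2; `BetaPertH` for Bałaban's β; continuum; Clay.
-/

namespace Summit.QuantumFields.BalabanUV.Beta.EriceFlowEnclosureB12AsPrintedHistoryNonunique

open Finset
open Literature.MathematicalPhysics.QuantumFieldTheory.Balaban1983to89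
open Literature.MathematicalPhysics.QuantumFieldTheory.Balaban1983to89.FlowStep (HBeta prefixOf Box mem_box box_mono RGEqH BetaLowerH
  BetaUpperH BetaContH BetaPertH)
open Literature.MathematicalPhysics.QuantumFieldTheory.Balaban1983to89.T4CouplingMatching (HistLipschitz FadingMemory)

noncomputable section

/-! ## §17 Elementary pieces -/

/-- The cut-off Fin-sum is the range sum: for n ≤ j + 1, Σ_{i : Fin (j+1), i < n} f i = Σ_{i<n} f i. [folklore] -/
theorem truncSum_eq (f : ℕ → ℝ) {n j : ℕ} (hn : n ≤ j + 1) :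
    ∑ i : Fin (j + 1), (if (i : ℕ) < n then f i else 0) = ∑ i ∈ range n, f i := by
  rw [Fin.sum_univ_eq_sum_range (fun i => if i < n then f i else 0) (j + 1), ← Finset.sum_filter]
  congr 1
  ext i
  simp only [mem_filter, mem_range]
  omega

/-- The Fin-sum concentrated on the last index: Σ_{i : Fin (j+1)} 𝟙[i = j]·c·f i = c·f (last). [folklore] -/
theorem lastSum_eq {j : ℕ} (f : Fin (j + 1) → ℝ) (c : ℝ) :
    ∑ i : Fin (j + 1), (if (i : ℕ) = j then c else 0) * f i = c * f (Fin.last j) := by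
  rw [Finset.sum_eq_single (Fin.last j)]
  · rw [Fin.val_last, if_pos rfl]
  · intro i _ hi
    have : (i : ℕ) ≠ j := fun h => hi (Fin.ext (by rw [Fin.val_last]; exact h))
    rw [if_neg this, zero_mul]
  · intro h; exact absurd (Finset.mem_univ _) h

/-- The concavity estimate behind the size of M: for x > 0, Δ ≥ 0, `Δ∕(2(x + Δ)√(x + Δ)) ≤ 1∕√x − 1∕√(x + Δ)`. [folklore] -/
theorem inv_sqrt_sub_ge {x Δ : ℝ} (hx : 0 < x) (hΔ : 0 ≤ Δ) :
    Δ / (2 * (x + Δ) * Real.sqrt (x + Δ)) ≤ 1 / Real.sqrt x - 1 / Real.sqrt (x + Δ) := by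
  set p := Real.sqrt x with hp
  set q := Real.sqrt (x + Δ) with hq
  have hp0 : 0 < p := Real.sqrt_pos.mpr hx
  have hq0 : 0 < q := Real.sqrt_pos.mpr (by linarith)
  have hpq : p ≤ q := Real.sqrt_le_sqrt (by linarith)
  have hp2 : p ^ 2 = x := Real.sq_sqrt hx.le
  have hq2 : q ^ 2 = x + Δ := Real.sq_sqrt (by linarith)
  have hΔ' : Δ = q ^ 2 - p ^ 2 := by rw [hp2, hq2]; ring
  rw [show 2 * (x + Δ) * q = 2 * q ^ 2 * q by rw [hq2], hΔ',
    show 1 / p - 1 / q = (q - p) / (p * q) by field_simp,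
    div_le_div_iff₀ (by positivity) (by positivity)]
  have h1 : (q ^ 2 - p ^ 2) * (p * q) = (q - p) * ((q + p) * (p * q)) := by ring
  rw [h1]
  refine mul_le_mul_of_nonneg_left ?_ (sub_nonneg.mpr hpq)
  nlinarith [mul_pos hp0 hq0, mul_nonneg (sub_nonneg.mpr hpq) hq0.le, mul_nonneg (sub_nonneg.mpr hpq) (mul_nonneg hq0.le hq0.le),
    mul_nonneg (sub_nonneg.mpr hpq) (mul_nonneg hp0.le hq0.le)]

/-- For Δ ≤ (5∕4)·x: `(2∕3)·(1∕√x) ≤ 1∕√(x + Δ)` (run B's couplings are at least two thirds of run A's). [folklore] -/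
theorem inv_sqrt_ge_two_thirds {x Δ : ℝ} (hx : 0 < x) (hΔ : 0 ≤ Δ) (hΔx : Δ ≤ 5 / 4 * x) :
    2 / 3 * (1 / Real.sqrt x) ≤ 1 / Real.sqrt (x + Δ) := by
  have hq0 : 0 < Real.sqrt (x + Δ) := Real.sqrt_pos.mpr (by linarith)
  have hp0 : 0 < Real.sqrt x := Real.sqrt_pos.mpr hx
  have hle : Real.sqrt (x + Δ) ≤ 3 / 2 * Real.sqrt x := by
    rw [show 3 / 2 * Real.sqrt x = Real.sqrt ((3 / 2) ^ 2 * x) by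
      rw [Real.sqrt_mul' _ hx.le, Real.sqrt_sq (by norm_num)]]
    exact Real.sqrt_le_sqrt (by linarith)
  rw [show 2 / 3 * (1 / Real.sqrt x) = 1 / (3 / 2 * Real.sqrt x) by field_simp]
  exact one_div_le_one_div_of_le hq0 hle

/-- The bump value lies in [0, 1] (M ≥ 0): 0 ≤ max(1 − |s|∕M, 0) ≤ 1. [folklore] -/
theorem bump_mem_Icc (s : ℝ) {M : ℝ} (hM : 0 ≤ M) : 0 ≤ max (1 - |s| / M) 0 ∧ max (1 - |s| / M) 0 ≤ 1 := by
  refine ⟨le_max_right _ _, max_le ?_ zero_le_one⟩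
  have : 0 ≤ |s| / M := div_nonneg (abs_nonneg s) hM
  linarith

/-- The bump is (1∕M)-Lipschitz in its argument: |max(1 − |s|∕M, 0) − max(1 − |t|∕M, 0)| ≤ |s − t|∕M (M > 0). [folklore] -/
theorem bump_sub_le (s t : ℝ) {M : ℝ} (hM : 0 < M) :
    |max (1 - |s| / M) 0 - max (1 - |t| / M) 0| ≤ |s - t| / M := by
  refine (abs_max_sub_max_le_abs _ _ _).trans ?_
  rw [show (1 - |s| / M) - (1 - |t| / M) = (|t| - |s|) / M by ring, abs_div, abs_of_pos hM]
  exact div_le_div_of_nonneg_right ((abs_abs_sub_abs_le_abs_sub t s).trans (abs_sub_comm t s).le) hM.le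

/-! ## §18 The letters of the bump family -/

/-- **AF lower letter**: `b ≤ β_{j+1}` on every box (ε ≥ 0, M ≥ 0, 0 ≤ χ). [folklore] -/
theorem betaLowerH_of_bumpFamily {β : HBeta} {b ε M : ℝ} {n : ℕ} {gB : ℕ → ℝ} {χ : ℝ → ℝ}
    (hβ : ∀ (j : ℕ) (p : Fin (j + 1) → ℝ), β j p = b + (if n ≤ j ∧ j < 2 * n then
      ε * max (1 - |∑ i : Fin (j + 1), (if (i : ℕ) < n then p i - gB i else 0)| / M) 0 * χ (p (Fin.last j)) else 0))
    (hε : 0 ≤ ε) (hM : 0 ≤ M) (hχ : ∀ s, 0 ≤ χ s ∧ χ s ≤ 1) (γ : ℝ) : BetaLowerH b γ β := by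
  intro k v _
  rw [hβ k v]
  split_ifs with hband
  · exact le_add_of_nonneg_right (mul_nonneg (mul_nonneg hε (bump_mem_Icc _ hM).1) (hχ _).1)
  · simp

/-- **Upper letter**: `β_{j+1} ≤ b + ε` on every box. [folklore] -/
theorem betaUpperH_of_bumpFamily {β : HBeta} {b ε M : ℝ} {n : ℕ} {gB : ℕ → ℝ} {χ : ℝ → ℝ}
    (hβ : ∀ (j : ℕ) (p : Fin (j + 1) → ℝ), β j p = b + (if n ≤ j ∧ j < 2 * n then
      ε * max (1 - |∑ i : Fin (j + 1), (if (i : ℕ) < n then p i - gB i else 0)| / M) 0 * χ (p (Fin.last j)) else 0))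
    (hε : 0 ≤ ε) (hM : 0 ≤ M) (hχ : ∀ s, 0 ≤ χ s ∧ χ s ≤ 1) (γ : ℝ) : BetaUpperH (b + ε) γ β := by
  intro k v _
  rw [hβ k v]
  split_ifs with hband
  · have h1 := bump_mem_Icc (∑ i : Fin (k + 1), (if (i : ℕ) < n then v i - gB i else 0)) hM
    have h2 := hχ (v (Fin.last k))
    have : max (1 - |∑ i : Fin (k + 1), (if (i : ℕ) < n then v i - gB i else 0)| / M) 0 * χ (v (Fin.last k)) ≤ 1 := by
      calc _ ≤ 1 * 1 := mul_le_mul h1.2 h2.2 h2.1 zero_le_one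
        _ = 1 := one_mul 1
    nlinarith
  · simp [hε]

/-- **THE HISTORY MODULI OF THE FAMILY**: `HistLipschitz Λ γ β` with Λ j i = 𝟙[n ≤ j < 2n]·(ε∕M·𝟙[i < n] + ε·L_χ·𝟙[i = j]) — β_{j+1} feels EACH
of the n oldest couplings p₀, …, p_{n−1} with the SAME strength ε∕M (no decay in the age j − i: NOT fading memory) and the last one through χ.
(M > 0, ε ≥ 0, 0 ≤ χ ≤ 1 and χ L_χ-Lipschitz on [0, γ].) [folklore] -/
theorem histLipschitz_of_bumpFamily {β : HBeta} {b ε M Lχ : ℝ} {n : ℕ} {gB : ℕ → ℝ} {χ : ℝ → ℝ}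
    (hβ : ∀ (j : ℕ) (p : Fin (j + 1) → ℝ), β j p = b + (if n ≤ j ∧ j < 2 * n then
      ε * max (1 - |∑ i : Fin (j + 1), (if (i : ℕ) < n then p i - gB i else 0)| / M) 0 * χ (p (Fin.last j)) else 0))
    (hε : 0 ≤ ε) (hM : 0 < M) (hχ : ∀ s, 0 ≤ χ s ∧ χ s ≤ 1) {γ : ℝ}
    (hχL : ∀ s t, s ∈ Set.Icc (0 : ℝ) γ → t ∈ Set.Icc (0 : ℝ) γ → |χ s - χ t| ≤ Lχ * |s - t|) :
    HistLipschitz (fun j i => if n ≤ j ∧ j < 2 * n then (if i < n then ε / M else 0) + (if i = j then ε * Lχ else 0) else 0) γ β := by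
  intro k p q hp hq
  rw [hβ k p, hβ k q]
  by_cases hband : n ≤ k ∧ k < 2 * n
  · simp only [hband, and_self, if_true]
    have hpl : p (Fin.last k) ∈ Set.Icc (0 : ℝ) γ := ⟨(mem_box.mp hp _).1.le, (mem_box.mp hp _).2⟩
    have hql : q (Fin.last k) ∈ Set.Icc (0 : ℝ) γ := ⟨(mem_box.mp hq _).1.le, (mem_box.mp hq _).2⟩
    set sp := ∑ i : Fin (k + 1), (if (i : ℕ) < n then p i - gB i else 0) with hsp
    set sq := ∑ i : Fin (k + 1), (if (i : ℕ) < n then q i - gB i else 0) with hsq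
    set mp := max (1 - |sp| / M) 0 with hmp
    set mq := max (1 - |sq| / M) 0 with hmq
    have hmq01 := bump_mem_Icc sq hM.le
    have hχp := hχ (p (Fin.last k))
    -- the two sources of variation
    have h1 : |mp - mq| ≤ |sp - sq| / M := bump_sub_le sp sq hM
    have h2 : |sp - sq| ≤ ∑ i : Fin (k + 1), (if (i : ℕ) < n then |p i - q i| else 0) := by
      have hdiff : sp - sq = ∑ i : Fin (k + 1), (if (i : ℕ) < n then p i - q i else 0) := by
        rw [hsp, hsq, ← Finset.sum_sub_distrib]
        refine Finset.sum_congr rfl fun i _ => ?_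
        split_ifs <;> ring
      rw [hdiff]
      refine (Finset.abs_sum_le_sum_abs _ _).trans (Finset.sum_le_sum fun i _ => ?_)
      split_ifs <;> simp
    have h3 : |χ (p (Fin.last k)) - χ (q (Fin.last k))| ≤ Lχ * |p (Fin.last k) - q (Fin.last k)| := hχL _ _ hpl hql
    have hkey : |mp * χ (p (Fin.last k)) - mq * χ (q (Fin.last k))|
        ≤ |sp - sq| / M + Lχ * |p (Fin.last k) - q (Fin.last k)| := by
      have e : mp * χ (p (Fin.last k)) - mq * χ (q (Fin.last k))
          = (mp - mq) * χ (p (Fin.last k)) + mq * (χ (p (Fin.last k)) - χ (q (Fin.last k))) := by ring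
      rw [e]
      refine (abs_add_le _ _).trans ?_
      rw [abs_mul, abs_mul, abs_of_nonneg hχp.1, abs_of_nonneg hmq01.1]
      have ha : |mp - mq| * χ (p (Fin.last k)) ≤ |sp - sq| / M :=
        (mul_le_mul h1 hχp.2 hχp.1 (div_nonneg (abs_nonneg _) hM.le)).trans (mul_one _).le
      have hb : mq * |χ (p (Fin.last k)) - χ (q (Fin.last k))| ≤ Lχ * |p (Fin.last k) - q (Fin.last k)| :=
        (mul_le_mul hmq01.2 h3 (abs_nonneg _) zero_le_one).trans (one_mul _).le
      linarith
    -- the right member, unfolded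
    have hR : ∑ i : Fin (k + 1), ((if (i : ℕ) < n then ε / M else 0) + (if (i : ℕ) = k then ε * Lχ else 0)) * |p i - q i|
        = ε / M * ∑ i : Fin (k + 1), (if (i : ℕ) < n then |p i - q i| else 0) + ε * Lχ * |p (Fin.last k) - q (Fin.last k)| := by
      simp only [add_mul, Finset.sum_add_distrib]
      congr 1
      · rw [Finset.mul_sum]
        refine Finset.sum_congr rfl fun i _ => ?_
        split_ifs <;> ring
      · exact lastSum_eq (fun i => |p i - q i|) (ε * Lχ)
    have hLHS : |b + ε * mp * χ (p (Fin.last k)) - (b + ε * mq * χ (q (Fin.last k)))|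
        = ε * |mp * χ (p (Fin.last k)) - mq * χ (q (Fin.last k))| := by
      rw [show b + ε * mp * χ (p (Fin.last k)) - (b + ε * mq * χ (q (Fin.last k)))
          = ε * (mp * χ (p (Fin.last k)) - mq * χ (q (Fin.last k))) by ring, abs_mul, abs_of_nonneg hε]
    rw [hLHS, hR]
    have h4 : ε * |mp * χ (p (Fin.last k)) - mq * χ (q (Fin.last k))|
        ≤ ε * (|sp - sq| / M + Lχ * |p (Fin.last k) - q (Fin.last k)|) := mul_le_mul_of_nonneg_left hkey hε
    have h5 : ε * (|sp - sq| / M) ≤ ε / M * ∑ i : Fin (k + 1), (if (i : ℕ) < n then |p i - q i| else 0) := by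
      rw [show ε * (|sp - sq| / M) = ε / M * |sp - sq| by ring]
      exact mul_le_mul_of_nonneg_left h2 (div_nonneg hε hM.le)
    linarith
  · simp only [hband, if_false, add_zero, sub_self, abs_zero, zero_mul, Finset.sum_const_zero, le_refl]

/-- **… AND THEY ARE UNIFORM (θ = 1): `FadingMemory C 1 Λ`** for the family's moduli as soon as ε∕M ≤ C and ε·L_χ ≤ C — ONE constant for every
age; for n ≤ j < 2n the modulus of the OLDEST coupling p₀ is the full ε∕M, so `FadingMemory C θ Λ` with θ < 1 forces C ≥ (ε∕M)·θ^{−j},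
unbounded in the depth. [folklore] -/
theorem uniformModulus_of_bumpFamily {ε M Lχ C : ℝ} {n : ℕ} (hε : 0 ≤ ε) (hM : 0 < M) (hLχ : 0 ≤ Lχ)
    (hC1 : ε / M ≤ C) (hC2 : ε * Lχ ≤ C) :
    FadingMemory C 1 (fun j i => if n ≤ j ∧ j < 2 * n then (if i < n then ε / M else 0) + (if i = j then ε * Lχ else 0) else 0) := by
  have hC : 0 ≤ C := (div_nonneg hε hM.le).trans hC1
  intro k i hik
  simp only [one_pow, mul_one]
  have h1 : (0 : ℝ) ≤ (if i < n then ε / M else 0) := by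
    split_ifs
    · exact div_nonneg hε hM.le
    · exact le_rfl
  have h2 : (0 : ℝ) ≤ (if i = k then ε * Lχ else 0) := by
    split_ifs
    · exact mul_nonneg hε hLχ
    · exact le_rfl
  by_cases hband : n ≤ k ∧ k < 2 * n
  · rw [if_pos hband]
    refine ⟨add_nonneg h1 h2, ?_⟩
    by_cases hi : i < n
    · have hik' : i ≠ k := by omega
      rw [if_pos hi, if_neg hik', add_zero]; exact hC1
    · rw [if_neg hi, zero_add]
      by_cases hik' : i = k
      · rw [if_pos hik']; exact hC2
      · rw [if_neg hik']; exact hC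
  · rw [if_neg hband]; exact ⟨le_rfl, hC⟩

/-- **(C) holds**: each β_{j+1} of the family is jointly continuous (χ continuous). [folklore] -/
theorem betaContH_of_bumpFamily {β : HBeta} {b ε M : ℝ} {n : ℕ} {gB : ℕ → ℝ} {χ : ℝ → ℝ}
    (hβ : ∀ (j : ℕ) (p : Fin (j + 1) → ℝ), β j p = b + (if n ≤ j ∧ j < 2 * n then
      ε * max (1 - |∑ i : Fin (j + 1), (if (i : ℕ) < n then p i - gB i else 0)| / M) 0 * χ (p (Fin.last j)) else 0))
    (hχc : Continuous χ) (γ : ℝ) : BetaContH γ β := by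
  intro k
  have hfun : β k = fun p => b + (if n ≤ k ∧ k < 2 * n then
      ε * max (1 - |∑ i : Fin (k + 1), (if (i : ℕ) < n then p i - gB i else 0)| / M) 0 * χ (p (Fin.last k)) else 0) :=
    funext (hβ k)
  rw [hfun]
  refine Continuous.continuousOn ?_
  by_cases hband : n ≤ k ∧ k < 2 * n
  · simp only [hband, and_self, if_true]
    have hs : Continuous fun p : Fin (k + 1) → ℝ => ∑ i : Fin (k + 1), (if (i : ℕ) < n then p i - gB i else 0) := by
      refine continuous_finsetSum _ fun i _ => ?_
      split_ifs
      · exact (continuous_apply i).sub continuous_const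
      · exact continuous_const
    have hm : Continuous fun p : Fin (k + 1) → ℝ =>
        max (1 - |∑ i : Fin (k + 1), (if (i : ℕ) < n then p i - gB i else 0)| / M) 0 :=
      (continuous_const.sub ((continuous_abs.comp hs).div_const M)).max continuous_const
    exact continuous_const.add ((continuous_const.mul hm).mul (hχc.comp (continuous_apply (Fin.last k))))
  · simp only [hband, if_false, add_zero]
    exact continuous_const

/-- **The bump VANISHES on small boxes**: if M = Σ_{i<n}(gᴬ_i − gᴮ_i) > 0 and n·γ′ ≤ Σ_{i<n}(2gᴮ_i − gᴬ_i), then at every p ∈ ]0, γ′]^{j+1} with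
n ≤ j + 1 the argument Σ_{i<n}(p_i − gᴮ_i) ≤ −M, so max(1 − |·|∕M, 0) = 0. [folklore] -/
theorem bump_zero_of_smallBox {M γ' : ℝ} {n j : ℕ} {gA gB : ℕ → ℝ} (hM : M = ∑ i ∈ range n, (gA i - gB i)) (hMpos : 0 < M)
    (hsmall : (n : ℝ) * γ' ≤ ∑ i ∈ range n, (2 * gB i - gA i)) (hn : n ≤ j + 1) {p : Fin (j + 1) → ℝ} (hp : p ∈ Box γ' j) :
    max (1 - |∑ i : Fin (j + 1), (if (i : ℕ) < n then p i - gB i else 0)| / M) 0 = 0 := by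
  refine max_eq_right ?_
  set s := ∑ i : Fin (j + 1), (if (i : ℕ) < n then p i - gB i else 0) with hs
  have hle : s ≤ -M := by
    have h1 : s ≤ ∑ i : Fin (j + 1), (if (i : ℕ) < n then γ' - gB i else 0) := by
      refine Finset.sum_le_sum fun i _ => ?_
      split_ifs
      · exact sub_le_sub_right (mem_box.mp hp i).2 _
      · exact le_rfl
    rw [truncSum_eq (fun i => γ' - gB i) hn] at h1
    have h2 : ∑ i ∈ range n, (γ' - gB i) = (n : ℝ) * γ' - ∑ i ∈ range n, gB i := by
      rw [Finset.sum_sub_distrib, Finset.sum_const, card_range, nsmul_eq_mul]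
    have h3 : ∑ i ∈ range n, (2 * gB i - gA i) = ∑ i ∈ range n, gB i - M := by
      rw [hM, ← Finset.sum_sub_distrib]; exact Finset.sum_congr rfl fun i _ => by ring
    linarith
  have habs : M ≤ |s| := by
    rw [abs_of_nonpos (by linarith)]; linarith
  have : 1 ≤ |s| / M := by rw [le_div_iff₀ hMpos, one_mul]; exact habs
  linarith

/-- **EVEN THE WALL LETTER HOLDS: `BetaPertH β b`** (|β_{j+1} − b| ≤ C_p·γ′² on ]0, γ′]^{j+1} for every small γ′) with ANY prescribed constant
C_p ≥ 0 and window γ₀ > 0: on boxes with γ′ ≤ τ the bump vanishes (hypothesis `hvan`, supplied by `bump_zero_of_smallBox`), so β ≡ b there;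
on larger boxes |β − b| ≤ ε ≤ C_p·τ² ≤ C_p·γ′². [folklore] -/
theorem betaPertH_of_bumpFamily {β : HBeta} {b ε M Cp τ γ₀ : ℝ} {n : ℕ} {gB : ℕ → ℝ} {χ : ℝ → ℝ}
    (hβ : ∀ (j : ℕ) (p : Fin (j + 1) → ℝ), β j p = b + (if n ≤ j ∧ j < 2 * n then
      ε * max (1 - |∑ i : Fin (j + 1), (if (i : ℕ) < n then p i - gB i else 0)| / M) 0 * χ (p (Fin.last j)) else 0))
    (hε : 0 ≤ ε) (hM : 0 ≤ M) (hχ : ∀ s, 0 ≤ χ s ∧ χ s ≤ 1) (hCp : 0 ≤ Cp) (hτ : 0 < τ) (hγ₀ : 0 < γ₀)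
    (hvan : ∀ γ' : ℝ, 0 < γ' → γ' ≤ τ → ∀ (j : ℕ) (p : Fin (j + 1) → ℝ), n ≤ j → p ∈ Box γ' j →
      max (1 - |∑ i : Fin (j + 1), (if (i : ℕ) < n then p i - gB i else 0)| / M) 0 = 0)
    (hετ : ε ≤ Cp * τ ^ 2) : BetaPertH β b := by
  refine ⟨γ₀, hγ₀, Cp, hCp, fun γ' hγ' _ k v hv => ?_⟩
  rw [hβ k v, add_sub_cancel_left]
  split_ifs with hband
  · rcases le_or_gt γ' τ with hle | hlt
    · rw [hvan γ' hγ' hle k v hband.1 hv, mul_zero, zero_mul, abs_zero]; positivity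
    · have h1 := bump_mem_Icc (∑ i : Fin (k + 1), (if (i : ℕ) < n then v i - gB i else 0)) hM
      have h2 := hχ (v (Fin.last k))
      have h3 : max (1 - |∑ i : Fin (k + 1), (if (i : ℕ) < n then v i - gB i else 0)| / M) 0 * χ (v (Fin.last k)) ≤ 1 := by
        calc _ ≤ 1 * 1 := mul_le_mul h1.2 h2.2 h2.1 zero_le_one
          _ = 1 := one_mul 1
      rw [abs_of_nonneg (mul_nonneg (mul_nonneg hε h1.1) h2.1)]
      have hτγ : τ ^ 2 ≤ γ' ^ 2 := pow_le_pow_left₀ hτ.le hlt.le 2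
      calc ε * max (1 - |∑ i : Fin (k + 1), (if (i : ℕ) < n then v i - gB i else 0)| / M) 0 * χ (v (Fin.last k))
          = ε * (max (1 - |∑ i : Fin (k + 1), (if (i : ℕ) < n then v i - gB i else 0)| / M) 0 * χ (v (Fin.last k))) := by ring
        _ ≤ ε * 1 := mul_le_mul_of_nonneg_left h3 hε
        _ ≤ Cp * τ ^ 2 := by rw [mul_one]; exact hετ
        _ ≤ Cp * γ' ^ 2 := mul_le_mul_of_nonneg_left hτγ hCp
  · rw [abs_zero]; positivity

end

end Summit.QuantumFields.BalabanUV.Beta.EriceFlowEnclosureB12AsPrintedHistoryNonunique
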